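import Literature.NumberTheory.EllipticCurves.ModularCurve
import Literature.NumberTheory.EllipticCurves.ModularCurveNeronLatticeProofs
import HarnessLib

/-!
# Modular parametrisations: the decomposition of `nonempty_modularParametrizationData`
(trunk EllArithM, item C17, named fact `Literature.NumberTheory.EllipticCurves.ModularForms.nonempty_modularParametrizationData`)

`nonempty_modularParametrizationData` (file `ModularCurve.lean`) asserts that every elliptic curve
`E/ℚ`, given by a globally minimal model `W` of conductor `N_E = W.conductorNorm ℤ`, admits a
`ModularParametrizationData W N_E`: its newform `f`, a Néron lattice `L` of the model, the complex
uniformisation `ℂ →+ E(ℂ)` with kernel `Λ_E = L.lattice`, an integer `c` (the Manin constant)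
with `c Λ_f ⊆ Λ_E`, and the modular degree `deg` (all but finitely many points of `E(ℂ)` have
exactly `deg` `Γ₀(N_E)`-orbits of preimages under `τ ↦ uniformize (c · 2πi ∫_{i∞}^τ f)`).

Mathematically this is the **Modularity Theorem** of Breuil–Conrad–Diamond–Taylor (2001),
Thm. A — "if `E/ℚ` is an elliptic curve, then `E` is modular" — where *modular* means any of
the six equivalent conditions listed on p. 845 of that paper, in particular
(2) `L(E, s) = L(f, s)` for an eigenform `f` of weight `2` and level `N(E)`, and
(6) there is a non-constant morphism `X₁(N(E)) → E` defined over `ℚ`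
((2) ⇒ (6) "follows from a construction of Shimura and a theorem of Faltings", loc. cit.),
made explicit by the Eichler–Shimura construction (Knapp 1993, Thm. 11.74: `X₀(N) → E_f ≅ ℂ/Λ_f`,
pull-back of the invariant differential a multiple of `f(τ) dτ`), together with two results of a
different nature: the complex uniformisation `ℂ/Λ ≅ E(ℂ)` of elliptic curves and the
integrality of the Manin constant. None of these is in Mathlib, and each is a theory of its own,
so the fact is **decomposed** here into four named facts and the assembly is proved:

1. `exists_isNewformOf` (file `CuspFormLFunction.lean`) — modularity in the form (2):
   a newform `f ∈ S₂(Γ₀(N_E))` with `aₙ(f) = aₙ(E)` for all `n`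
   (BCDT Thm. A; level `N_E` by Carayol; Diamond–Shurman Thm. 8.8.3);
2. `exists_isNeronLatticeOf` (file `ModularCurve.lean`) — the uniformisation theorem: a period
   pair `L` with `g₂(L) = c₄/12`, `g₃(L) = c₆/216` (Silverman AEC VI.5.1); **discharged** in the
   tree as `exists_isNeronLatticeOf_holds` (file `ModularCurveNeronLatticeProofs.lean`);
3. `IsNeronLatticeOf.exists_uniformize` (this file) — for such `L`,
   `z ↦ (℘_L(z) − b₂/12, (℘_L'(z) − a₁x − a₃)/2)` extends to a surjective group homomorphism
   `ℂ →+ E(ℂ)` with kernel `L.lattice` (Silverman AEC VI.3.6(b));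
4. `IsNewformOf.exists_maninConstant_modularDegree` (this file) — the modular parametrisation in
   analytic form on `ℂ/Λ_E`: an integer `c` with `c Λ_f ⊆ Λ_E` and a `d ≥ 1` such that
   `τ ↦ c · 2πi ∫_{i∞}^τ f (mod Λ_E)` has, off a finite subset of `ℂ/Λ_E`, fibres consisting of
   exactly `d` orbits of `Γ₀(N)` in `ℍ` (BCDT Thm. A in the form (6); Knapp Thm. 11.74 and
   Thm. 12.7; `c ∈ ℤ`: Edixhoven 1991, Prop. 2 = Agashe–Ribet–Stein 2006, Thm. 2.2, with the
   functoriality of Néron models for the isogeny to the optimal curve; fibres of a non-constant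
   holomorphic map of compact Riemann surfaces: Farkas–Kra, Prop. I.1.6).

`nonempty_modularParametrizationData_of` assembles 1–4 into the fact (sorry-free); the only step
beyond bookkeeping is the transport of the fibre count along the group isomorphism
`ℂ/Λ_E ≃ E(ℂ)` induced by the uniformisation (Mathlib `QuotientAddGroup.liftEquiv`).
`nonempty_modularParametrizationData_of_facts` feeds in the discharged fact 2, leaving the three
open named facts 1, 3, 4 as hypotheses; `nonempty_modularParametrizationData_holds` will follow from
their discharges.
Conversely `ModularParametrizationData.exists_maninConstant_modularDegree` recovers the conclusion
of 4 from a parametrisation datum, so 4 asks for no more than the structure contains.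

## Design notes

* Fact 4 is phrased on the complex torus `ℂ ⧸ L.lattice.toAddSubgroup` (Mathlib
  `QuotientAddGroup`) rather than on `E(ℂ)`, so that it does not depend on the uniformisation
  (facts 3 and 4 are logically independent; the Manin constant and the degree are invariants of
  `X₀(N) → ℂ/Λ_f → ℂ/Λ_E`). The level `N` is any level carrying a newform of `W`
  (`IsNewformOf W f`; then `N = N_W` by Carayol, `IsNewformOf.level_eq_conductorNorm`), as in
  `ModularParametrizationData W N`.
* `[W.IsGloballyMinimal]` is kept in fact 4, as in the target: it is what makes the lattice pinned
  by `IsNeronLatticeOf (W.baseChange ℂ) L` the Néron lattice, hence `c` the Manin constant of the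
  parametrisation and `c ∈ ℤ` (for a non-minimal model `c` is only rational).
* `[W.IsElliptic]` in fact 3 is implied by `IsNeronLatticeOf W L` (Silverman AEC VI.3.6(a):
  `Δ(L) ≠ 0`); it is kept, as in `exists_isNeronLatticeOf` and `IsNeronLatticeOf.nonsingular`,
  because every user has it and the source states (b) for "the curve `E`, which from (a) is an
  elliptic curve".
* Nothing here is specific to the conductor: the assembly is stated at level `N_E` only because
  the target is.

## References

* C. Breuil, B. Conrad, F. Diamond, R. Taylor, *On the modularity of elliptic curves over `ℚ`:
  wild 3-adic exercises*, J. Amer. Math. Soc. 14 (2001), 843–939: Thm. A and the list (1)–(6),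
  p. 845.
* A. W. Knapp, *Elliptic curves*, Math. Notes 40, Princeton (1993): Thm. 11.74 (Eichler–Shimura),
  §XII.1 with Thm. 12.7 (modular parametrisations of isogenous curves), Thm. 12.8 (Carayol).
* J. H. Silverman, *The arithmetic of elliptic curves*, 2nd ed., GTM 106 (2009): Prop. VI.3.6,
  Thm. VI.5.1, Cor. VI.5.1.1.
* B. Edixhoven, *On the Manin constants of modular elliptic curves*, in Arithmetic algebraic
  geometry (Texel, 1989), Progr. Math. 89 (1991), 25–39: Prop. 2.
* A. Agashe, K. Ribet, W. A. Stein, *The Manin constant*, Pure Appl. Math. Q. 2 (2006), 617–636: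
  §2, Thm. 2.2.
* J. H. Silverman, *Advanced topics in the arithmetic of elliptic curves*, GTM 151 (1994):
  IV.5.1 (Néron mapping property), IV.6.1, IV.9.1 (minimal Weierstrass model and Néron model).
* H. M. Farkas, I. Kra, *Riemann surfaces*, 2nd ed., GTM 71 (1992): Prop. I.1.6.
* J. E. Cremona, *Algorithms for modular elliptic curves*, 2nd ed. (1997), §2.6, §2.10.
-/

noncomputable section

open scoped MatrixGroups ModularForm

open CongruenceSubgroup UpperHalfPlane Complex

namespace Literature.NumberTheory.EllipticCurves.ModularForms

/-! ### Fact 3: complex uniformisation of a Weierstrass model by its Néron lattice -/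

section Uniformization

/-- **Complex uniformisation as a group isomorphism** (Silverman AEC Prop. VI.3.6(b), transported
along the change of variables `x = ℘ − b₂/12`, `2y + a₁x + a₃ = ℘'` of AEC III.§1): if the
period pair `L` satisfies `g₂(L) = c₄(W)/12`, `g₃(L) = c₆(W)/216` (`IsNeronLatticeOf W L`) for an
elliptic curve `W/ℂ`, then there is a surjective group homomorphism `u : ℂ →+ W(ℂ)` with kernel
exactly `L.lattice` which off the lattice is
`z ↦ (℘_L(z) − b₂/12, (℘_L'(z) − a₁(℘_L(z) − b₂/12) − a₃)/2)` (and is `O` on the lattice); i.e.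
`z ↦ [℘(z), ℘'(z), 1]` is "a complex analytic isomorphism of complex Lie groups
`ℂ/Λ → E_Λ(ℂ)`" for `E_Λ : y² = 4x³ − g₂x − g₃`, composed with the algebraic group isomorphism
`E_Λ ≅ W` above. Only the group-theoretic content is recorded (it is what
`ModularParametrizationData.uniformize` consumes); that the points are on `W` and nonsingular is
`IsNeronLatticeOf.nonsingular`. Mathlib has `℘`, `℘'` and `℘'² = 4℘³ − g₂℘ − g₃`
(`PeriodPair.derivWeierstrassP_sq`) but neither the addition theorem nor the surjectivity.
[cite: SilvermanAEC2009, Prop. VI.3.6(b)] -/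
def IsNeronLatticeOf.exists_uniformize : Prop :=
  ∀ {W : WeierstrassCurve ℂ} [W.IsElliptic] {L : PeriodPair} (_ : IsNeronLatticeOf W L),
    ∃ u : ℂ →+ W.toAffine.Point,
      (u.ker : Set ℂ) = L.lattice ∧ Function.Surjective u ∧
        ∀ z ∉ L.lattice, ∃ h,
          u z = .some (L.weierstrassP z - W.b₂ / 12)
            ((L.derivWeierstrassP z - W.a₁ * (L.weierstrassP z - W.b₂ / 12) - W.a₃) / 2) h

end Uniformization

/-! ### Fact 4: the modular parametrisation with an integral Manin constant, analytically -/

section ManinConstant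

/-- **Modular parametrisation `X₀(N) → ℂ/Λ_f → ℂ/Λ_E` with integral Manin constant**
(analytic form). Let `W/ℚ` be a globally minimal model of an elliptic curve, `f ∈ S₂(Γ₀(N))` its
newform (`IsNewformOf W f`: `aₙ(f) = aₙ(W)`), and `L` a period pair spanning the Néron lattice
`Λ_E` of `W` (`IsNeronLatticeOf (W.baseChange ℂ) L`). Then there are an integer `c` with
`c Λ_f ⊆ Λ_E` (`Λ_f = periodLattice f`, the Eichler–Shimura period lattice of item C9) and an
integer `d ≥ 1` such that for all but finitely many `P ∈ ℂ/Λ_E` there are exactly `d` orbits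
`Γ₀(N)τ ∈ Y₀(N)` with `c · 2πi ∫_{i∞}^τ f ≡ P (mod Λ_E)` (`eichlerIntegral f τ = 2πi ∫_{i∞}^τ f`).

Provenance (no single printed statement; this is the part of `nonempty_modularParametrizationData`
left after splitting off modularity "Version `a_p`" and the complex uniformisation):
by the Modularity Theorem in the form (6) of Breuil–Conrad–Diamond–Taylor 2001, p. 845 — for
`f` as given, the Eichler–Shimura construction (Knapp 1993, Thm. 11.74) yields an elliptic curve
`E_f/ℚ` and a morphism `X₀(N) → E_f` over `ℚ`, `∞ ↦ O`, lifting to `τ ↦ 2πi ∫_{i∞}^τ f` on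
`ℍ → ℂ → ℂ/Λ_f ≅ E_f(ℂ)` (Thm. 11.74(c), (d)), and `L(E_f, s) = L(f, s) = L(W, s)` (Thm. 12.8 loc.
cit.; Carayol), so `E_f` is isogenous to `E` over `ℚ` (Faltings 1983) and composing gives a
non-constant morphism `φ : X₀(N) → E` over `ℚ` with `φ(∞) = O` (Knapp §XII.1, Thm. 12.7);
`φ^* ω_E = c · 2πi f(τ) dτ` with `c ∈ ℚˣ`, and `c ∈ ℤ`: for the optimal curve this is
Edixhoven 1991, Prop. 2 (= Agashe–Ribet–Stein 2006, Thm. 2.2), and the isogeny from the optimal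
curve extends to a homomorphism of Néron models (Néron mapping property, Silverman ATAEC IV.5.1,
IV.6.1) and pulls the Néron differential `ω_E` — the generator, up to sign, of the rank-one
`ℤ`-module of invariant differentials of the Néron model, which is `dx/(2y + a₁x + a₃)` of the
globally minimal model `W` (Agashe–Ribet–Stein §§1–2; ATAEC IV.9.1) — back to an integral
multiple of that of the optimal curve; lifting `φ` through the uniformisation
`ℂ → ℂ/Λ_E ≅ E(ℂ)` (`u^* ω_E = dz`) gives
`τ ↦ c · 2πi ∫_{i∞}^τ f` and `c{∞, γ∞}_f ∈ Λ_E` for `γ ∈ Γ₀(N)`, i.e. `c Λ_f ⊆ Λ_E`; finally a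
non-constant holomorphic map of compact Riemann surfaces of degree `d` takes every value `d`
times counting multiplicities (Farkas–Kra, Prop. I.1.6), so off the finitely many branch values
and images of cusps every fibre consists of exactly `d` points of `Y₀(N)`.
[cite: BCDTJAMS2001, Thm. A with (6) of p. 845] [cite: Knapp1993, Thm. 11.74 and Thm. 12.7]
[cite: EdixhovenManin1991, Prop. 2] [cite: AgasheRibetStein2006, Thm. 2.2]
[cite: FarkasKra1992, Prop. I.1.6] -/
def IsNewformOf.exists_maninConstant_modularDegree : Prop :=
  ∀ {W : WeierstrassCurve ℚ} [W.IsElliptic] [W.IsGloballyMinimal] {N : ℕ} [NeZero N]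
    {f : CuspForm (Gamma0 N) 2} (_ : IsNewformOf W f) {L : PeriodPair}
    (_ : IsNeronLatticeOf (W.baseChange ℂ) L),
    ∃ c : ℤ, (∀ z ∈ periodLattice f, (c : ℂ) * z ∈ L.lattice) ∧
      ∃ d : ℕ, 0 < d ∧
        {P : ℂ ⧸ L.lattice.toAddSubgroup |
            Nat.card {y : Y0 N // ∃ τ : ℍ, Y0.mk N τ = y ∧
              (((c : ℂ) * eichlerIntegral f τ : ℂ) : ℂ ⧸ L.lattice.toAddSubgroup) = P} ≠ d}.Finite

end ManinConstant

/-! ### Transport of fibre counts along `ℂ/Λ_E ≃ E(ℂ)` -/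

section Transport

variable {N : ℕ} {A B : Type*} (e : A ≃ B) (g : ℍ → A)

/-- If `e : A ≃ B`, the number of `Γ₀(N)`-orbits `y ∈ Y₀(N)` having a representative `τ` with
`g τ = P` equals the number having a representative with `e (g τ) = e P`. (Used with `e` the group
isomorphism `ℂ/Λ_E ≃ E(ℂ)` induced by the uniformisation.) [folklore] -/
theorem card_fiberOrbits_congr (P : A) :
    Nat.card {y : Y0 N // ∃ τ : ℍ, Y0.mk N τ = y ∧ e (g τ) = e P} =
      Nat.card {y : Y0 N // ∃ τ : ℍ, Y0.mk N τ = y ∧ g τ = P} :=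
  Nat.card_congr <| Equiv.subtypeEquivRight fun _ ↦
    exists_congr fun _ ↦ and_congr_right fun _ ↦ e.injective.eq_iff

/-- Finiteness of the exceptional set `{P | #(orbit-fibre over P) ≠ d}` is invariant under a
bijection `e : A ≃ B` of the target. [folklore] -/
theorem finite_setOf_card_fiberOrbits_ne_iff (d : ℕ) :
    {Q : B | Nat.card {y : Y0 N // ∃ τ : ℍ, Y0.mk N τ = y ∧ e (g τ) = Q} ≠ d}.Finite ↔
      {P : A | Nat.card {y : Y0 N // ∃ τ : ℍ, Y0.mk N τ = y ∧ g τ = P} ≠ d}.Finite := by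
  have hS : {Q : B | Nat.card {y : Y0 N // ∃ τ : ℍ, Y0.mk N τ = y ∧ e (g τ) = Q} ≠ d} =
      e '' {P : A | Nat.card {y : Y0 N // ∃ τ : ℍ, Y0.mk N τ = y ∧ g τ = P} ≠ d} := by
    ext Q
    simp only [Set.mem_setOf_eq, Set.mem_image]
    constructor
    · intro hQ
      refine ⟨e.symm Q, ?_, e.apply_symm_apply Q⟩
      rwa [← card_fiberOrbits_congr e g, e.apply_symm_apply]
    · rintro ⟨P, hP, rfl⟩
      rwa [card_fiberOrbits_congr e g]
  rw [hS, Set.finite_image_iff e.injective.injOn]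

end Transport

/-! ### The assembly -/

section Assembly

/-- **Assembly of `nonempty_modularParametrizationData`** from the four named facts: modularity
"Version `a_p`" (`exists_isNewformOf`, BCDT Thm. A), existence of the Néron lattice
(`exists_isNeronLatticeOf`, Silverman AEC VI.5.1), the complex uniformisation as a group
homomorphism (`IsNeronLatticeOf.exists_uniformize`, AEC VI.3.6(b)) and the modular parametrisation
with integral Manin constant on `ℂ/Λ_E` (`IsNewformOf.exists_maninConstant_modularDegree`).
The fibre-count field `deg_spec` is transported along
`QuotientAddGroup.liftEquiv : ℂ/Λ_E ≃+ E(ℂ)`.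
[cite: BCDTJAMS2001, Thm. A] -/
theorem nonempty_modularParametrizationData_of (h₁ : exists_isNewformOf)
    (h₂ : exists_isNeronLatticeOf) (h₃ : IsNeronLatticeOf.exists_uniformize)
    (h₄ : IsNewformOf.exists_maninConstant_modularDegree) :
    nonempty_modularParametrizationData := by
  intro W _ _ _
  haveI : (W.baseChange ℂ).IsElliptic := by rw [WeierstrassCurve.baseChange]; infer_instance
  obtain ⟨f, hf⟩ := h₁ W
  obtain ⟨L, hL⟩ := h₂ (W.baseChange ℂ)
  obtain ⟨u, hker, hsurj, hspec⟩ := h₃ hL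
  obtain ⟨c, hc, d, hd, hfin⟩ := h₄ hf hL
  have hker' : L.lattice.toAddSubgroup = u.ker :=
    SetLike.coe_injective (by rw [Submodule.coe_toAddSubgroup, hker])
  let e : ℂ ⧸ L.lattice.toAddSubgroup ≃+ (W.baseChange ℂ).toAffine.Point :=
    QuotientAddGroup.liftEquiv L.lattice.toAddSubgroup hsurj hker'
  have he : ∀ x : ℂ, e.toEquiv (x : ℂ ⧸ L.lattice.toAddSubgroup) = u x := fun _ ↦ rfl
  have key := (finite_setOf_card_fiberOrbits_ne_iff e.toEquiv
    (fun τ : ℍ ↦ (((c : ℂ) * eichlerIntegral f τ : ℂ) : ℂ ⧸ L.lattice.toAddSubgroup)) d).mpr hfin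
  simp only [he] at key
  exact ⟨{
    f := f
    isNewformOf := hf
    L := L
    isNeronLattice := hL
    uniformize := u
    ker_uniformize := hker
    uniformize_surjective := hsurj
    uniformize_spec := hspec
    c := c
    smul_periodLattice_le := hc
    deg := d
    deg_pos := hd
    deg_spec := key }⟩

/-- `nonempty_modularParametrizationData` from the three *open* named facts — modularity
(`exists_isNewformOf`), complex uniformisation as a group homomorphism
(`IsNeronLatticeOf.exists_uniformize`) and the parametrisation with integral Manin constant
(`IsNewformOf.exists_maninConstant_modularDegree`) — the existence of the Néron lattice being the
discharged `exists_isNeronLatticeOf_holds` (Silverman AEC VI.5.1, file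
`ModularCurveNeronLatticeProofs.lean`). [cite: BCDTJAMS2001, Thm. A] -/
theorem nonempty_modularParametrizationData_of_facts (h₁ : exists_isNewformOf)
    (h₃ : IsNeronLatticeOf.exists_uniformize)
    (h₄ : IsNewformOf.exists_maninConstant_modularDegree) : nonempty_modularParametrizationData :=
  nonempty_modularParametrizationData_of h₁ exists_isNeronLatticeOf_holds h₃ h₄

end Assembly

/-! ### The converse: a parametrisation datum contains the data of fact 4 -/

namespace ModularParametrizationData

variable {W : WeierstrassCurve ℚ} {N : ℕ} [NeZero N] (D : ModularParametrizationData W N)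

/-- A parametrisation datum `D` yields the conclusion of
`IsNewformOf.exists_maninConstant_modularDegree` for its own newform and lattice: `c = D.c`,
`d = D.deg`, the exceptional set being transported back along `ℂ/Λ_E ≃ E(ℂ)`. (So fact 4 asks
for nothing beyond the structure.) [folklore] -/
theorem exists_maninConstant_modularDegree :
    ∃ c : ℤ, (∀ z ∈ periodLattice D.f, (c : ℂ) * z ∈ D.L.lattice) ∧
      ∃ d : ℕ, 0 < d ∧
        {P : ℂ ⧸ D.L.lattice.toAddSubgroup |
            Nat.card {y : Y0 N // ∃ τ : ℍ, Y0.mk N τ = y ∧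
              (((c : ℂ) * eichlerIntegral D.f τ : ℂ) : ℂ ⧸ D.L.lattice.toAddSubgroup) = P}
              ≠ d}.Finite := by
  have hker' : D.L.lattice.toAddSubgroup = D.uniformize.ker :=
    SetLike.coe_injective (by rw [Submodule.coe_toAddSubgroup, D.ker_uniformize])
  let e : ℂ ⧸ D.L.lattice.toAddSubgroup ≃+ (W.baseChange ℂ).toAffine.Point :=
    QuotientAddGroup.liftEquiv D.L.lattice.toAddSubgroup D.uniformize_surjective hker'
  have he : ∀ x : ℂ, e.toEquiv (x : ℂ ⧸ D.L.lattice.toAddSubgroup) = D.uniformize x :=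
    fun _ ↦ rfl
  refine ⟨D.c, D.smul_periodLattice_le, D.deg, D.deg_pos, ?_⟩
  refine (finite_setOf_card_fiberOrbits_ne_iff e.toEquiv
    (fun τ : ℍ ↦ (((D.c : ℂ) * eichlerIntegral D.f τ : ℂ) : ℂ ⧸ D.L.lattice.toAddSubgroup))
    D.deg).mp ?_
  simp only [he]
  exact D.deg_spec

end ModularParametrizationData

end Literature.NumberTheory.EllipticCurves.ModularForms

end
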